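import Mathlib.MeasureTheory.Integral.IntervalIntegral.FundThmCalculus
import Mathlib.Analysis.Calculus.Deriv.Shift
import Literature.Analysis.UnboundedOperators.StrongContRepresentation
import HarnessLib

/-!
# The generator of a C₀-semigroup is densely defined (discharge of `dense_generator_domain`)

Sibling proof file of `Literature/Analysis/UnboundedOperators/StrongContRepresentation.lean`
(item C3, `C0Semigroup`), which records the named fact

* `Literature.Analysis.UnboundedOperators.C0Semigroup.dense_generator_domain`:
  the generator `A` of a C₀-semigroup `(T(t))_{t ≥ 0}` on a Banach space is densely defined
  (Engel–Nagel (2000), Ch. II Thm. 1.4; Hille–Phillips (1957), Thm. 10.3.4).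

This file proves it (`C0Semigroup.dense_generator_domain_holds`) along the printed proof
(Engel–Nagel, Ch. II Lemma 1.3 (iii)–(iv) and Thm. 1.4), in "real time" `s ↦ T(s⁺) x`
(`s⁺ = Real.toNNReal s`, the parametrisation used by `C0Semigroup.generatorGraph`):

* `C0Semigroup.app_integral_app_toNNReal`: `T(h) ∫ₐᵇ T(s) x ds = ∫_{a+h}^{b+h} T(s) x ds`
  (`0 ≤ a, b, h`);
* `C0Semigroup.hasDerivWithinAt_app_integral`: `h ↦ T(h) ∫₀ᵗ T(s) x ds` has right derivative
  `T(t) x - x` at `h = 0`, because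
  `h⁻¹ (T(h) - 1) ∫₀ᵗ T(s) x ds = h⁻¹ ∫ₜ^{t+h} T(s) x ds - h⁻¹ ∫₀ʰ T(s) x ds`
  (fundamental theorem of calculus for the continuous orbit); hence
  `C0Semigroup.integral_mem_generator_domain`: `∫₀ᵗ T(s) x ds ∈ D(A)` and
  `A ∫₀ᵗ T(s) x ds = T(t) x - x` (Engel–Nagel Lemma II.1.3 (iii), (iv));
* `C0Semigroup.tendsto_inv_smul_integral_app_toNNReal`: `t⁻¹ ∫₀ᵗ T(s) x ds → x` as `t → 0`
  (strong continuity), so every `x` is a limit of elements of `D(A)`: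
  `C0Semigroup.dense_generator_domain_of_normedSpace_real` (for any real structure on `E`
  compatible with the `𝕜`-structure) and the discharge `C0Semigroup.dense_generator_domain_holds`
  (the real structure restricted from `𝕜`, `NormedSpace.restrictScalars ℝ 𝕜 E`).

The group case (`OneParameterGroup.dense_generator_domain`) is in
`Literature/Analysis/UnboundedOperators/UnitaryGroupGenerator.lean`; the semigroup case differs
only in that the shift `h` is restricted to `h ≥ 0` (one-sided derivative at `0`).

## References

* K.-J. Engel, R. Nagel, *One-Parameter Semigroups for Linear Evolution Equations* (Springer
  GTM 194, 2000), Ch. II Def. 1.2, Lemma 1.3, Thm. 1.4 (same text and numbering in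
  K.-J. Engel, R. Nagel, *A Short Course on Operator Semigroups*, Universitext, Springer 2006,
  Ch. II §1). [EngelNagel2000]
* E. Hille, R. S. Phillips, *Functional Analysis and Semi-Groups* (AMS Coll. Publ. 31, 1957),
  Thm. 10.3.4.

## Design notes

* The interval integral and one-dimensional derivatives use a real normed-space structure on `E`;
  the lemmas are stated for any `[NormedSpace ℝ E]` (plus `[IsScalarTower ℝ 𝕜 E]` where the
  `𝕜`-valued difference quotient of `generatorGraph` is compared with real slopes), exactly as
  in `UnitaryGroupGenerator.lean`. The named fact itself carries no real structure, so the
  discharge installs `NormedSpace.restrictScalars ℝ 𝕜 E` locally (`IsScalarTower.restrictScalars`).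
* No definitions; theorems only.
-/

noncomputable section

open Filter Topology MeasureTheory intervalIntegral
open scoped NNReal

namespace Literature.Analysis.UnboundedOperators

namespace C0Semigroup

section Banach

variable {𝕜 E : Type*} [RCLike 𝕜] [NormedAddCommGroup E] [NormedSpace 𝕜 E]

/-- The orbit of a C₀-semigroup in real time, `s ↦ T(s⁺) x` (constant `= x` for `s ≤ 0`), is
continuous (strong continuity, Engel–Nagel (2000), Ch. I Def. 5.1).
[cite: EngelNagel2000, Ch. I Def. 5.1] -/
@[continuity, fun_prop]
theorem continuous_app_toNNReal (T : C0Semigroup 𝕜 E) (x : E) :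
    Continuous fun s : ℝ => T.app s.toNNReal x :=
  (T.continuous_app x).comp continuous_real_toNNReal

/-- Orbits of a C₀-semigroup (in real time) are interval integrable, being continuous
(Engel–Nagel (2000), Ch. I Def. 5.1). [cite: EngelNagel2000, Ch. I Def. 5.1] -/
theorem intervalIntegrable_app_toNNReal (T : C0Semigroup 𝕜 E) (x : E) (a b : ℝ) :
    IntervalIntegrable (fun s : ℝ => T.app s.toNNReal x) volume a b :=
  (T.continuous_app_toNNReal x).intervalIntegrable a b

/-- The semigroup law in real time: `T(h) T(s) x = T(s + h) x` for `0 ≤ s`, `0 ≤ h`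
(Engel–Nagel (2000), Ch. I Def. 5.1 (FE)). [cite: EngelNagel2000, Ch. I Def. 5.1] -/
theorem app_toNNReal_app_toNNReal (T : C0Semigroup 𝕜 E) {s h : ℝ} (hs : 0 ≤ s) (hh : 0 ≤ h)
    (x : E) : T.app h.toNNReal (T.app s.toNNReal x) = T.app (s + h).toNNReal x := by
  rw [Real.toNNReal_add hs hh, app_add, app_comm, mul_apply_eq_comp]

variable [NormedSpace ℝ E]

section Tower

variable [IsScalarTower ℝ 𝕜 E]

/-- If the orbit `s ↦ T(s) z` has right derivative `y` at `s = 0`, then `z ∈ D(A)` and `A z = y`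
(this is the definition of the generator, Engel–Nagel (2000), Ch. II Def. 1.2 and (1.4), with the
real slope `s⁻¹ • (T(s) z - z)` identified with the `𝕜`-scalar difference quotient of
`C0Semigroup.generatorGraph`). [cite: EngelNagel2000, Ch. II Def. 1.2] -/
theorem mem_generator_domain_of_hasDerivWithinAt (T : C0Semigroup 𝕜 E) {z y : E}
    (h : HasDerivWithinAt (fun s : ℝ => T.app s.toNNReal z) y (Set.Ici 0) 0) :
    ∃ hz : z ∈ T.generator.domain, T.generator ⟨z, hz⟩ = y := by
  have ht : Tendsto (fun s : ℝ => ((s⁻¹ : ℝ) : 𝕜) • (T.app s.toNNReal z - z)) (𝓝[>] 0) (𝓝 y) := by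
    rw [hasDerivWithinAt_iff_tendsto_slope, Set.Ici_sdiff_left] at h
    refine h.congr' ?_
    filter_upwards [self_mem_nhdsWithin] with s (_hs : 0 < s)
    rw [slope_def_module, sub_zero, Real.toNNReal_zero, app_zero, one_apply_eq_self,
      RCLike.real_smul_eq_coe_smul (K := 𝕜)]
  have hz : z ∈ T.generator.domain := (T.mem_generator_domain_iff z).mpr ⟨y, ht⟩
  exact ⟨hz, T.generator_apply_eq_of_tendsto ⟨z, hz⟩ ht⟩

end Tower

variable [CompleteSpace E]

/-- `T(h) ∫ₐᵇ T(s) x ds = ∫_{a+h}^{b+h} T(s) x ds` for `0 ≤ a, b, h` (a bounded operator commutes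
with the Bochner integral, then the semigroup law and a change of variables; Engel–Nagel (2000),
proof of Ch. II Lemma 1.3 (iv)). [cite: EngelNagel2000, Ch. II Lemma 1.3] -/
theorem app_integral_app_toNNReal (T : C0Semigroup 𝕜 E) (x : E) {a b h : ℝ} (ha : 0 ≤ a)
    (hb : 0 ≤ b) (hh : 0 ≤ h) :
    T.app h.toNNReal (∫ s in a..b, T.app s.toNNReal x) =
      ∫ s in (a + h)..(b + h), T.app s.toNNReal x := by
  rw [← (T.app h.toNNReal).intervalIntegral_comp_comm (T.intervalIntegrable_app_toNNReal x a b),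
    ← intervalIntegral.integral_comp_add_right (fun s => T.app s.toNNReal x) h]
  refine intervalIntegral.integral_congr fun s hs => ?_
  have hs0 : 0 ≤ s := by
    rcases Set.mem_uIcc.mp hs with h' | h'
    · exact ha.trans h'.1
    · exact hb.trans h'.1
  exact T.app_toNNReal_app_toNNReal hs0 hh x

/-- **Engel–Nagel Lemma II.1.3 (iv), derivative form (semigroup case).** For `t ≥ 0` and every
`x`, `h ↦ T(h) ∫₀ᵗ T(s) x ds` has right derivative `T(t) x - x` at `h = 0`: indeed
`T(h) ∫₀ᵗ T(s) x ds = ∫ₕ^{t+h} T(s) x ds = ∫₀^{t+h} T(s) x ds - ∫₀ʰ T(s) x ds` for `h ≥ 0`, and both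
terms are differentiable at `h = 0` by the fundamental theorem of calculus (continuous orbit).
[cite: EngelNagel2000, Ch. II Lemma 1.3 (iv)] -/
theorem hasDerivWithinAt_app_integral (T : C0Semigroup 𝕜 E) (x : E) {t : ℝ} (ht : 0 ≤ t) :
    HasDerivWithinAt (fun h : ℝ => T.app h.toNNReal (∫ s in (0 : ℝ)..t, T.app s.toNNReal x))
      (T.app t.toNNReal x - x) (Set.Ici 0) 0 := by
  have hg : Continuous fun s : ℝ => T.app s.toNNReal x := T.continuous_app_toNNReal x
  have h1 : HasDerivAt (fun h : ℝ => ∫ s in (0 : ℝ)..(t + h), T.app s.toNNReal x)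
      (T.app t.toNNReal x) 0 := by
    have := (hg.integral_hasStrictDerivAt 0 (t + 0)).hasDerivAt.comp_const_add t 0
    simpa only [add_zero] using this
  have h2 : HasDerivAt (fun h : ℝ => ∫ s in (0 : ℝ)..(0 + h), T.app s.toNNReal x) x 0 := by
    have := (hg.integral_hasStrictDerivAt 0 (0 + 0)).hasDerivAt.comp_const_add 0 0
    simpa only [add_zero, Real.toNNReal_zero, app_zero, one_apply_eq_self] using this
  refine (h1.sub h2).hasDerivWithinAt.congr (fun h (hh : 0 ≤ h) => ?_) ?_
  · rw [Pi.sub_apply, T.app_integral_app_toNNReal x le_rfl ht hh,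
      intervalIntegral.integral_interval_sub_left (hg.intervalIntegrable _ _)
        (hg.intervalIntegrable _ _)]
  · rw [Pi.sub_apply, add_zero, add_zero, intervalIntegral.integral_same, sub_zero,
      Real.toNNReal_zero, app_zero, one_apply_eq_self]

/-- `t⁻¹ ∫₀ᵗ T(s) x ds → x` as `t → 0`, `t ≠ 0` (strong continuity and the fundamental theorem of
calculus; Engel–Nagel (2000), proof of Ch. II Thm. 1.4, density of the generator domain).
[cite: EngelNagel2000, Ch. II Thm. 1.4] -/
theorem tendsto_inv_smul_integral_app_toNNReal (T : C0Semigroup 𝕜 E) (x : E) :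
    Tendsto (fun t : ℝ => t⁻¹ • ∫ s in (0 : ℝ)..t, T.app s.toNNReal x) (𝓝[≠] 0) (𝓝 x) := by
  have h := ((T.continuous_app_toNNReal x).integral_hasStrictDerivAt 0 0).hasDerivAt
  rw [hasDerivAt_iff_tendsto_slope] at h
  simp only [Real.toNNReal_zero, app_zero, one_apply_eq_self] at h
  refine h.congr' (Eventually.of_forall fun t => ?_)
  simp only [slope_def_module, sub_zero, intervalIntegral.integral_same]

variable [IsScalarTower ℝ 𝕜 E]

/-- **Engel–Nagel Lemma II.1.3 (iii)–(iv) (semigroup case).** For `t ≥ 0` and every `x`,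
`∫₀ᵗ T(s) x ds ∈ D(A)` and `A ∫₀ᵗ T(s) x ds = T(t) x - x`.
[cite: EngelNagel2000, Ch. II Lemma 1.3 (iii)] -/
theorem integral_mem_generator_domain (T : C0Semigroup 𝕜 E) (x : E) {t : ℝ} (ht : 0 ≤ t) :
    ∃ hx : (∫ s in (0 : ℝ)..t, T.app s.toNNReal x) ∈ T.generator.domain,
      T.generator ⟨_, hx⟩ = T.app t.toNNReal x - x :=
  T.mem_generator_domain_of_hasDerivWithinAt (T.hasDerivWithinAt_app_integral x ht)

/-- **Engel–Nagel Thm. II.1.4 (density), semigroup case**, for a Banach space carrying a real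
structure compatible with its `𝕜`-structure: the generator of a C₀-semigroup is densely defined
(`t⁻¹ ∫₀ᵗ T(s) x ds ∈ D(A)` tends to `x` as `t ↓ 0`). [cite: EngelNagel2000, Ch. II Thm. 1.4] -/
theorem dense_generator_domain_of_normedSpace_real (T : C0Semigroup 𝕜 E) :
    Dense (T.generator.domain : Set E) := by
  intro x
  refine mem_closure_of_tendsto
    ((T.tendsto_inv_smul_integral_app_toNNReal x).mono_left (nhdsGT_le_nhdsNE 0)) ?_
  filter_upwards [self_mem_nhdsWithin] with t (ht : 0 < t)
  rw [RCLike.real_smul_eq_coe_smul (K := 𝕜)]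
  exact Submodule.smul_mem _ _ (T.integral_mem_generator_domain x ht.le).1

end Banach

section Discharge

variable {𝕜 E : Type*} [RCLike 𝕜] [NormedAddCommGroup E] [NormedSpace 𝕜 E]

/-- **Discharge of `C0Semigroup.dense_generator_domain` (Engel–Nagel Thm. II.1.4; Hille–Phillips
Thm. 10.3.4).** The generator of a C₀-semigroup on a Banach space over `𝕜 = ℝ` or `ℂ` is densely
defined. Obtained from `dense_generator_domain_of_normedSpace_real` for the real structure
restricted from `𝕜` (`NormedSpace.restrictScalars ℝ 𝕜 E`, a scalar tower by
`IsScalarTower.restrictScalars`). [cite: EngelNagel2000, Ch. II Thm. 1.4] -/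
theorem dense_generator_domain_holds : dense_generator_domain (𝕜 := 𝕜) (E := E) := by
  intro _ T
  letI : NormedSpace ℝ E := NormedSpace.restrictScalars ℝ 𝕜 E
  haveI : IsScalarTower ℝ 𝕜 E := IsScalarTower.restrictScalars ℝ 𝕜 E
  exact T.dense_generator_domain_of_normedSpace_real

end Discharge

end C0Semigroup

end Literature.Analysis.UnboundedOperators
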